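import Mathlib.Analysis.Calculus.Deriv.MeanValue
import Literature.Geometry.Lorentzian.CauchyHypersurfaceCausalProofs
import Literature.Geometry.Lorentzian.LorentzianDistance
import HarnessLib

/-!
# Timelike rays: no future endpoint under a uniform timelike bound, and eventual containment in
the causal future of a Cauchy hypersurface

Two elementary facts of Lorentzian causality about a future timelike curve `γ` on a parameter ray
`[a, ∞)` of a `Cⁿ` time-oriented Lorentzian manifold `(M, g, T)`:

* `TimeOrientation.not_tendsto_atTop_of_val_velocity_le`: if `g(γ', γ') ≤ -k < 0` and `γ'` is
  future-directed on `[a, ∞)`, then `γ(s)` converges to no point of `M` as `s → ∞`; hence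
  (`TimeOrientation.isFutureEndless_Ici_of_val_velocity_le`) such a curve is future endless
  (`IsFutureEndless`, Hawking–Ellis 1973, §6.2). Proof: in the extended chart `φ` at a would-be
  limit `P`, the linear "time function" `z ↦ -Ĝ_{φ P}(T̂_{φ P}, z)` increases along `φ ∘ γ` at a
  rate bounded below — a uniform cone estimate `-Ĝ₀(T̂₀, u) ≥ μ ‖u‖` for vectors `u` which are
  causal and future for the nearby forms `Ĝ_z` (reverse Cauchy–Schwarz, O'Neill 1983, Ch. 5,
  Lemma 5.26 and Prop. 5.30, plus compactness of the unit sphere of the finite-dimensional model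
  space), together with `‖u‖² ≥ k / ‖Ĝ_z‖` — while it converges: a contradiction.
* `LorentzianMetric.IsCauchyHypersurface.exists_forall_mem_causalFuture_of_isFutureEndless`: if
  `S` is a Cauchy hypersurface (O'Neill 1983, Ch. 14, Def. 14.28) and `γ` is future endless on
  `[a, ∞)`, then `γ s ∈ J⁺(S)` for all large `s` (extend `γ|[a, ∞)` to the past by an endless
  timelike curve, time dual of `LorentzianMetric.exists_isEndlessTimelikeCurve_extends_future`; it
  meets `S` once — on `γ`, or strictly before `γ a`, and then the ray stays in `I⁺(S)`).

Also recorded: the pointwise algebra `TimeOrientation.val_add_div_mul_sq_pos` behind the cone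
estimate and the arc-length lower bound `PseudoRiemannianMetric.ofReal_mul_le_arcLength`
(O'Neill 1983, Ch. 5, Def. 5.11). No definitions and no named facts are introduced. Deliberately
NOT here: finiteness or continuity of the time separation on globally hyperbolic sets (O'Neill
1983, Ch. 14, Lemma 14.21), and anything about strong causality.

## References

* B. O'Neill, *Semi-Riemannian geometry with applications to relativity*, Academic Press 1983,
  Ch. 5, Lemma 5.26, Prop. 5.30, Def. 5.11, pp. 144–146; Ch. 14, p. 402, Def. 14.28, Lemma 14.29
  (p. 415). Key `ONeillSemiRiemannian1983`.
* S. W. Hawking, G. F. R. Ellis, *The large scale structure of space-time*, CUP 1973, §6.2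
  (endpoints), §6.4–§6.5. Key `HawkingEllis1973CUP`.
-/

noncomputable section

open Bundle Set Filter Metric MeasureTheory
open scoped Manifold ContDiff Topology ENNReal

-- `maxSynthPendingDepth 2`: instance search on the nested operator space `E →L[ℝ] E →L[ℝ] ℝ`
-- (the chart expression of the metric) needs one more level of pending instance problems.
set_option maxSynthPendingDepth 2

namespace Literature.Geometry.Lorentzian

variable {E : Type*} [NormedAddCommGroup E] [NormedSpace ℝ E] {H : Type*} [TopologicalSpace H]
  {I : ModelWithCorners ℝ E H} {n : ℕ∞ω} {M : Type*} [TopologicalSpace M] [ChartedSpace H M]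
  [IsManifold I ∞ M]

namespace TimeOrientation

variable {g : LorentzianMetric I n M} (τ : TimeOrientation g)

/-! ### A coercive quadratic form attached to the orienting vector -/

/-- Pointwise algebra behind local time functions: for the orienting timelike vector `T` with
`β = -g(T,T) > 0`, the quadratic form `v ↦ g(v,v) + (2/β) g(T,v)²` is positive on nonzero vectors
(reverse Cauchy–Schwarz `g(T,T) g(v,v) ≤ g(T,v)²` plus positivity of `g` on `T^⊥`). O'Neill 1983,
Ch. 5, Lemma 5.26 and Prop. 5.30.
[cite: ONeillSemiRiemannian1983, Ch. 5, Lemma 5.26 and Prop. 5.30] -/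
theorem val_add_div_mul_sq_pos {x : M} (v : TangentSpace I x) (hv : v ≠ 0) :
    0 < g.val x v v + 2 / (-g.val x (τ.vectorField x) (τ.vectorField x)) *
      g.val x (τ.vectorField x) v ^ 2 := by
  have hT : g.val x (τ.vectorField x) (τ.vectorField x) < 0 := τ.isTimelike x
  have hcs := τ.mul_le_sq v
  set β := -g.val x (τ.vectorField x) (τ.vectorField x) with hβ
  have hβ0 : 0 < β := by rw [hβ]; linarith
  set sT := g.val x (τ.vectorField x) v with hsT
  have hTT : g.val x (τ.vectorField x) (τ.vectorField x) = -β := by rw [hβ]; ring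
  rw [hTT] at hcs
  have key : β * (g.val x v v + 2 / β * sT ^ 2) = β * g.val x v v + 2 * sT ^ 2 := by
    field_simp
  have hprod : 0 < β * (g.val x v v + 2 / β * sT ^ 2) := by
    rw [key]
    by_cases h0 : sT = 0
    · have hpos := g.pos_of_orthogonal x _ v hT (by rw [← hsT, h0]) hv
      rw [h0]
      nlinarith
    · have h1 : 0 < sT ^ 2 := by positivity
      nlinarith
  exact pos_of_mul_pos_right hprod hβ0.le

/-! ### A uniformly timelike future ray has no future endpoint -/

/-- **A curve whose velocity stays uniformly timelike, `g(γ', γ') ≤ -k < 0`, and future-directed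
on a parameter ray `[a, ∞)` does not converge as the parameter tends to `+∞`** (finite-dimensional
model space, model with corners without boundary, `Cⁿ` metric with `n ≥ 1`; no causality
condition). Near a would-be limit `P` the linear time function `z ↦ -Ĝ_{φ P}(T̂_{φ P}, z)` of the
extended chart `φ` at `P` increases along `φ ∘ γ` at a rate bounded below (uniform cone estimate
over a chart ball, from `val_add_div_mul_sq_pos` and compactness of the unit sphere, together with
`‖u‖² ≥ k / ‖Ĝ_z‖` for the coordinate velocity `u`), yet converges. O'Neill 1983, Ch. 5,
pp. 144–146 (timecones; Lemma 5.26, Prop. 5.30); Hawking–Ellis 1973, §6.4 (local time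
functions). [cite: ONeillSemiRiemannian1983, Ch. 5, Prop. 5.30 and pp. 144–146] -/
theorem not_tendsto_atTop_of_val_velocity_le [I.Boundaryless] [FiniteDimensional ℝ E]
    (hn : 1 ≤ n) {γ : ℝ → M} {a k : ℝ} (hk : 0 < k)
    (hγ : ∀ s, a ≤ s → MDifferentiableAt 𝓘(ℝ, ℝ) I γ s ∧
      g.val (γ s) (velocity I γ s) (velocity I γ s) ≤ -k ∧ τ.IsFutureDirected (velocity I γ s))
    (P : M) : ¬ Tendsto γ atTop (𝓝 P) := by
  intro hlim
  -- Step 1: chart data at `P`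
  set φ := extChartAt I P with hφ
  set z₀ : E := φ P with hz₀
  set G : E → E →L[ℝ] E →L[ℝ] ℝ := g.coordMetric P with hG
  set Th : E → E := τ.coordTime P with hTh
  set eT := trivializationAt E (TangentSpace I) P with heT
  have hz₀t : z₀ ∈ φ.target := mem_extChartAt_target P
  have htgt : φ.target ∈ 𝓝 z₀ := extChartAt_target_mem_nhds P
  have hGc : ContinuousAt G z₀ :=
    ((g.contDiffOn_coordMetric hn P).continuousOn.continuousWithinAt hz₀t).continuousAt htgt
  have hThc : ContinuousAt Th z₀ :=
    ((τ.continuousOn_coordTime hn P).continuousWithinAt hz₀t).continuousAt htgt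
  have hGTc : ContinuousAt (fun z ↦ G z (Th z)) z₀ := hGc.clm_apply hThc
  have hPsrc : P ∈ (chartAt H P).source := mem_chart_source H P
  have hPb : P ∈ eT.baseSet := by
    rw [heT, TangentBundle.trivializationAt_baseSet]; exact hPsrc
  have hsymm : φ.symm z₀ = P := extChartAt_to_inv P
  set T₀ : E := Th z₀ with hT₀
  -- the values at `z₀` in terms of `g` at `P`
  have hG₀ : ∀ v w : E, G z₀ v w = g.val P (eT.symmL ℝ P v) (eT.symmL ℝ P w) := by
    intro v w
    have h := g.coordMetric_apply hz₀t v w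
    rwa [hsymm] at h
  have hT₀' : eT.symmL ℝ P T₀ = τ.vectorField P := by
    have h := τ.coordTime_apply hz₀t
    rw [hsymm] at h
    rw [hT₀, hTh, h, Trivialization.symmL_continuousLinearMapAt _ hPb]
  have hinj : ∀ w : E, w ≠ 0 → eT.symmL ℝ P w ≠ 0 := by
    refine fun w hw h0 ↦ hw ?_
    have := congrArg (eT.continuousLinearMapAt ℝ P) h0
    rwa [Trivialization.continuousLinearMapAt_symmL _ hPb, map_zero] at this
  -- Step 2: `β = -g(T,T) > 0` and the coercive quadratic form `Rq`
  set β : ℝ := -G z₀ T₀ T₀ with hβ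
  have hβg : β = -g.val P (τ.vectorField P) (τ.vectorField P) := by
    rw [hβ, hG₀, hT₀']
  have hβ0 : 0 < β := by rw [hβg]; linarith [(g.isTimelike_iff _).mp (τ.isTimelike P)]
  set Rq : E → ℝ := fun w ↦ G z₀ w w + 2 / β * (G z₀ T₀ w) ^ 2 with hRq
  have hRc : Continuous Rq := by
    have h1 : Continuous fun w : E ↦ G z₀ w w :=
      (G z₀).continuous₂.comp (continuous_id.prodMk continuous_id)
    exact h1.add (continuous_const.mul ((G z₀ T₀).continuous.pow 2))
  have hRpos : ∀ w : E, w ≠ 0 → 0 < Rq w := by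
    intro w hw
    have h := τ.val_add_div_mul_sq_pos (eT.symmL ℝ P w) (hinj w hw)
    simp only [hRq, hG₀, hβg, hT₀']
    exact h
  have hRscale : ∀ (c : ℝ) (w : E), Rq (c • w) = c ^ 2 * Rq w := by
    intro c w
    simp only [hRq, map_smul, FunLike.coe_smul, Pi.smul_apply, smul_eq_mul]
    ring
  have hR0 : Rq 0 = 0 := by simp [hRq]
  obtain ⟨lam, hlam, hlamle⟩ : ∃ lam : ℝ, 0 < lam ∧ ∀ w : E, lam * ‖w‖ ^ 2 ≤ Rq w := by
    have hunit : ∀ w : E, w ≠ 0 → ‖w‖⁻¹ • w ∈ sphere (0 : E) 1 := fun w hw ↦ by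
      rw [mem_sphere_zero_iff_norm, norm_smul, norm_inv, norm_norm,
        inv_mul_cancel₀ (norm_ne_zero_iff.mpr hw)]
    rcases (sphere (0 : E) 1).eq_empty_or_nonempty with hs | hs
    · refine ⟨1, one_pos, fun w ↦ ?_⟩
      by_cases hw : w = 0
      · rw [hw, hR0]; simp
      · exact absurd (hs ▸ hunit w hw) (notMem_empty _)
    · obtain ⟨w₀, hw₀, hmin⟩ := (isCompact_sphere (0 : E) 1).exists_isMinOn hs hRc.continuousOn
      have hw₀ne : w₀ ≠ 0 := by rintro rfl; simp at hw₀
      refine ⟨Rq w₀, hRpos w₀ hw₀ne, fun w ↦ ?_⟩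
      by_cases hw : w = 0
      · rw [hw, hR0]; simp
      · have h1 : Rq w₀ ≤ Rq (‖w‖⁻¹ • w) := hmin (hunit w hw)
        rw [hRscale] at h1
        have hn0 : 0 < ‖w‖ := norm_pos_iff.mpr hw
        have h2 : ‖w‖⁻¹ ^ 2 * Rq w * ‖w‖ ^ 2 = Rq w := by field_simp
        calc Rq w₀ * ‖w‖ ^ 2 ≤ ‖w‖⁻¹ ^ 2 * Rq w * ‖w‖ ^ 2 := by gcongr
          _ = Rq w := h2
  -- Step 3: a ball on which `G` and `G(T̂, ·)` are close to their values at `z₀`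
  set μ : ℝ := Real.sqrt (lam * β) / 2 with hμ
  have hμ0 : 0 < μ := by positivity
  have hμsq : μ ^ 2 = lam * β / 4 := by
    rw [hμ, div_pow, Real.sq_sqrt (by positivity)]; norm_num
  obtain ⟨ρ, hρ, hballρ⟩ : ∃ ρ > 0, ∀ z : E, dist z z₀ < ρ →
      z ∈ φ.target ∧ ‖G z - G z₀‖ < lam / 2 ∧ ‖G z (Th z) - G z₀ T₀‖ < μ / 2 := by
    obtain ⟨ρ₁, hρ₁, h₁⟩ := Metric.continuousAt_iff.mp hGc (lam / 2) (by positivity)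
    obtain ⟨ρ₂, hρ₂, h₂⟩ := Metric.continuousAt_iff.mp hGTc (μ / 2) (by positivity)
    obtain ⟨ρ₃, hρ₃, h₃⟩ := Metric.mem_nhds_iff.mp htgt
    refine ⟨min ρ₁ (min ρ₂ ρ₃), lt_min hρ₁ (lt_min hρ₂ hρ₃), fun z hz ↦ ⟨?_, ?_, ?_⟩⟩
    · exact h₃ (mem_ball.mpr (hz.trans_le ((min_le_right _ _).trans (min_le_right _ _))))
    · rw [← dist_eq_norm]; exact h₁ (hz.trans_le (min_le_left _ _))
    · rw [← dist_eq_norm]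
      exact h₂ (hz.trans_le ((min_le_right _ _).trans (min_le_left _ _)))
  -- Step 4: the uniform cone estimate `-G₀(T₀, u) ≥ μ ‖u‖` for future causal `u` over the ball
  have hcone : ∀ z u, dist z z₀ < ρ → G z u u ≤ 0 → G z (Th z) u < 0 →
      μ * ‖u‖ ≤ -(G z₀ T₀ u) := by
    intro z u hz hQ hP
    obtain ⟨-, hG1, hG2⟩ := hballρ z hz
    have ha : G z₀ u u ≤ lam / 2 * ‖u‖ ^ 2 := by
      have h1 : |(G z - G z₀) u u| ≤ ‖G z - G z₀‖ * ‖u‖ * ‖u‖ := by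
        rw [← Real.norm_eq_abs]; exact (G z - G z₀).le_opNorm₂ u u
      have h2 : (G z - G z₀) u u = G z u u - G z₀ u u := by
        simp only [FunLike.coe_sub, Pi.sub_apply]
      rw [h2] at h1
      have h3 := (abs_le.mp h1).1
      have h4 : ‖G z - G z₀‖ * ‖u‖ * ‖u‖ ≤ lam / 2 * ‖u‖ ^ 2 := by
        rw [pow_two, ← mul_assoc]; gcongr
      linarith
    have hb : (μ * ‖u‖) ^ 2 ≤ (G z₀ T₀ u) ^ 2 := by
      have h1 := hlamle u
      simp only [hRq] at h1
      have h2 : lam / 2 * ‖u‖ ^ 2 ≤ 2 / β * (G z₀ T₀ u) ^ 2 := by linarith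
      have h3 : β * (lam / 2 * ‖u‖ ^ 2) ≤ β * (2 / β * (G z₀ T₀ u) ^ 2) :=
        mul_le_mul_of_nonneg_left h2 hβ0.le
      rw [mul_pow, hμsq]
      have h4 : β * (2 / β * (G z₀ T₀ u) ^ 2) = 2 * (G z₀ T₀ u) ^ 2 := by field_simp
      rw [h4] at h3
      nlinarith
    have hc : μ * ‖u‖ ≤ |G z₀ T₀ u| := by
      have h1 := Real.sqrt_le_sqrt hb
      rwa [Real.sqrt_sq (by positivity), Real.sqrt_sq_eq_abs] at h1
    rcases le_or_gt 0 (G z₀ T₀ u) with hsgn | hsgn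
    · exfalso
      have h1 : |(G z (Th z) - G z₀ T₀) u| ≤ ‖G z (Th z) - G z₀ T₀‖ * ‖u‖ := by
        rw [← Real.norm_eq_abs]; exact (G z (Th z) - G z₀ T₀).le_opNorm u
      have h2 : (G z (Th z) - G z₀ T₀) u = G z (Th z) u - G z₀ T₀ u := by
        simp only [FunLike.coe_sub, Pi.sub_apply]
      rw [h2] at h1
      have h3 := (abs_le.mp h1).1
      have h4 : ‖G z (Th z) - G z₀ T₀‖ * ‖u‖ ≤ μ / 2 * ‖u‖ := by gcongr
      rw [abs_of_nonneg hsgn] at hc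
      nlinarith [norm_nonneg u]
    · rw [abs_of_neg hsgn] at hc
      exact hc
  -- Step 5: a lower bound for the coordinate norm of uniformly timelike vectors over the ball
  set A : ℝ := ‖G z₀‖ + lam / 2 with hA
  have hA0 : 0 < A := by positivity
  have hnorm : ∀ z u, dist z z₀ < ρ → G z u u ≤ -k → Real.sqrt (k / A) ≤ ‖u‖ := by
    intro z u hz hQ
    obtain ⟨-, hG1, -⟩ := hballρ z hz
    have h1 : |G z u u| ≤ ‖G z‖ * ‖u‖ * ‖u‖ := by
      rw [← Real.norm_eq_abs]; exact (G z).le_opNorm₂ u u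
    have h2 : ‖G z‖ ≤ A := by have := norm_le_insert' (G z) (G z₀); rw [hA]; linarith
    have h3 : k ≤ A * ‖u‖ ^ 2 := by
      have := (abs_le.mp h1).1
      have h4 : ‖G z‖ * ‖u‖ * ‖u‖ ≤ A * ‖u‖ ^ 2 := by rw [pow_two, ← mul_assoc]; gcongr
      linarith
    have h5 : k / A ≤ ‖u‖ ^ 2 := by rw [div_le_iff₀ hA0]; linarith
    simpa only [Real.sqrt_sq (norm_nonneg u)] using Real.sqrt_le_sqrt h5
  set m' : ℝ := μ * Real.sqrt (k / A) with hm'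
  have hm'0 : 0 < m' := by positivity
  -- Step 6: the curve enters the chart and the ball, and stays
  have hφγ : Tendsto (φ ∘ γ) atTop (𝓝 z₀) := (continuousAt_extChartAt P).tendsto.comp hlim
  obtain ⟨s₂, hs₂⟩ : ∃ s₂, ∀ s, s₂ ≤ s → a ≤ s ∧ γ s ∈ (chartAt H P).source ∧
      dist (φ (γ s)) z₀ < ρ := by
    have h1 : ∀ᶠ s in atTop, γ s ∈ (chartAt H P).source :=
      hlim.eventually_mem ((chartAt H P).open_source.mem_nhds hPsrc)
    have h2 : ∀ᶠ s in atTop, dist ((φ ∘ γ) s) z₀ < ρ := hφγ.eventually_mem (ball_mem_nhds z₀ hρ)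
    exact eventually_atTop.mp ((eventually_ge_atTop a).and (h1.and h2))
  -- the coordinate velocity and its properties
  set uu : ℝ → E := fun s ↦ eT.continuousLinearMapAt ℝ (γ s) (velocity I γ s) with huu
  have hderiv : ∀ s, s₂ ≤ s → HasDerivAt (φ ∘ γ) (uu s) s := fun s hs ↦
    hasDerivAt_extChartAt_comp_continuousLinearMapAt (hγ s (hs₂ s hs).1).1 (hs₂ s hs).2.1
  have hrate : ∀ s, s₂ ≤ s → m' ≤ -(G z₀ T₀ (uu s)) := by
    intro s hs
    obtain ⟨has, hsrc, hdist⟩ := hs₂ s hs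
    obtain ⟨hd, hQ, hF⟩ := hγ s has
    have hQ' : G (φ (γ s)) (uu s) (uu s) ≤ -k := by
      rw [huu, hG, hφ, coordMetric_extChartAt_apply hsrc]; exact hQ
    have hF' := (isFutureDirected_iff_coord (p := P) hsrc (velocity I γ s)).mp hF
    have h1 := hcone (φ (γ s)) (uu s) hdist (by linarith) hF'.2
    have h2 := hnorm (φ (γ s)) (uu s) hdist hQ'
    calc m' = μ * Real.sqrt (k / A) := rfl
      _ ≤ μ * ‖uu s‖ := by gcongr
      _ ≤ -(G z₀ T₀ (uu s)) := h1
  -- Step 7: the time function `h = -G₀(T₀, φ ∘ γ)` grows at rate `≥ m'` yet converges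
  set ℓ : E →L[ℝ] ℝ := -(G z₀ T₀) with hℓ
  set h : ℝ → ℝ := fun s ↦ ℓ ((φ ∘ γ) s) with hh
  have hh' : ∀ s, s₂ ≤ s → HasDerivAt h (ℓ (uu s)) s := fun s hs ↦
    ℓ.hasFDerivAt.comp_hasDerivAt s (hderiv s hs)
  have hℓu : ∀ s, s₂ ≤ s → m' ≤ ℓ (uu s) := fun s hs ↦ by
    rw [hℓ, neg_apply]; exact hrate s hs
  have hmvt : ∀ s, s₂ ≤ s → m' * (s - s₂) ≤ h s - h s₂ := by
    have hcont : ContinuousOn h (Ici s₂) := fun s hs ↦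
      (hh' s hs).continuousAt.continuousWithinAt
    have hdiff : DifferentiableOn ℝ h (interior (Ici s₂)) := fun s hs ↦
      (hh' s (interior_subset hs)).differentiableAt.differentiableWithinAt
    have hge : ∀ s ∈ interior (Ici s₂), m' ≤ deriv h s := fun s hs ↦ by
      rw [(hh' s (interior_subset hs)).deriv]; exact hℓu s (interior_subset hs)
    intro s hs
    exact Convex.mul_sub_le_image_sub_of_le_deriv (convex_Ici s₂) hcont hdiff hge s₂ self_mem_Ici
      s hs hs
  have hlimh : Tendsto h atTop (𝓝 (ℓ z₀)) := (ℓ.continuous.tendsto z₀).comp hφγ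
  have hev : ∀ᶠ s in atTop, h s < ℓ z₀ + 1 := (tendsto_order.1 hlimh).2 _ (lt_add_one _)
  obtain ⟨s, hs₁, hs₂', hs₃⟩ : ∃ s, s₂ ≤ s ∧ (ℓ z₀ + 1 - h s₂) / m' + s₂ < s ∧ h s < ℓ z₀ + 1 :=
    (((eventually_ge_atTop s₂).and (eventually_gt_atTop _)).and hev).exists.imp
      fun s hs ↦ ⟨hs.1.1, hs.1.2, hs.2⟩
  have h1 := hmvt s hs₁
  have h2 : ℓ z₀ + 1 - h s₂ < (s - s₂) * m' := (div_lt_iff₀ hm'0).mp (by linarith)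
  linarith

/-- **A uniformly timelike future ray is future endless**: if `g(γ', γ') ≤ -k < 0` and `γ'` is
future-directed at every parameter of `[a, ∞)`, then `γ` has no future endpoint on `[a, ∞)`
(`IsFutureEndless`; by `not_tendsto_atTop_of_val_velocity_le`, a future endpoint on a ray being a
limit at `+∞`). Hawking–Ellis 1973, §6.2, p. 184 (endpoints); O'Neill 1983, Ch. 5, pp. 144–146.
[cite: HawkingEllis1973CUP, §6.2, p. 184] -/
theorem isFutureEndless_Ici_of_val_velocity_le [I.Boundaryless] [FiniteDimensional ℝ E]
    (hn : 1 ≤ n) {γ : ℝ → M} {a k : ℝ} (hk : 0 < k)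
    (hγ : ∀ s, a ≤ s → MDifferentiableAt 𝓘(ℝ, ℝ) I γ s ∧
      g.val (γ s) (velocity I γ s) (velocity I γ s) ≤ -k ∧ τ.IsFutureDirected (velocity I γ s)) :
    IsFutureEndless γ (Ici a) :=
  ⟨nonempty_Ici, fun P hP ↦ τ.not_tendsto_atTop_of_val_velocity_le hn hk hγ P
    ((hasFutureEndpoint_iff_tendsto_atTop Subset.rfl).mp hP)⟩

end TimeOrientation

namespace LorentzianMetric

variable {g : LorentzianMetric I n M} {τ : TimeOrientation g}

/-! ### A future-endless timelike ray is eventually in `J⁺` of a Cauchy hypersurface -/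

/-- **A future-endless future timelike ray is eventually in the causal future of a Cauchy
hypersurface.** On a Hausdorff, second countable, finite-dimensional manifold without boundary
with a `Cⁿ` (`n ≥ 2`) time-oriented Lorentzian metric, let `S` be a Cauchy hypersurface and `γ` a
future timelike curve on `[a, ∞)` without future endpoint. Then `γ s ∈ J⁺(S)` for all `s ≥ s₀`,
for some `s₀ ≥ a`. Extending `γ|[a, ∞)` to the past by an endless timelike curve (time dual of
`exists_isEndlessTimelikeCurve_extends_future`), the extension meets `S` exactly once (O'Neill
1983, Ch. 14, Def. 14.28), either on `γ` itself — after which `γ` stays in `J⁺(S)` along its own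
causal segments — or strictly before `γ a`, in which case `γ a ∈ I⁺(S)` and the whole ray lies in
`I⁺(S) ⊆ J⁺(S)` (transitivity of `≪`, O'Neill 1983, Ch. 14, p. 402).
[cite: ONeillSemiRiemannian1983, Ch. 14, Def. 14.28 and Lemma 14.29 (p. 415)] -/
theorem IsCauchyHypersurface.exists_forall_mem_causalFuture_of_isFutureEndless [T2Space M]
    [SecondCountableTopology M] [BoundarylessManifold I M] [FiniteDimensional ℝ E] (hn : 2 ≤ n)
    {S : Set M} (hS : g.IsCauchyHypersurface τ S) {γ : ℝ → M} {a : ℝ}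
    (hγ : g.IsFutureTimelikeCurveOn τ γ (Ici a)) (hend : IsFutureEndless γ (Ici a)) :
    ∃ s₀, a ≤ s₀ ∧ ∀ s, s₀ ≤ s → γ s ∈ g.causalFuture τ S := by
  -- time reversal: `t ↦ γ (-t)` is future timelike for `-T` on `(-∞, -a]`, past endless
  have hpre : Neg.neg ⁻¹' (Ici a) = Iic (-a) := by
    ext t
    simp only [mem_preimage, mem_Ici, mem_Iic]
    exact le_neg
  have hβ : g.IsFutureTimelikeCurveOn τ.reverse (fun t ↦ γ (-t)) (Iic (-a)) := by
    have h := hγ.comp_neg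
    rwa [hpre] at h
  have hβend : IsPastEndless (fun t ↦ γ (-t)) (Iic (-a)) := by
    have h := (isPastEndless_comp_neg_iff (γ := γ) (s := Ici a)).mpr hend
    rwa [hpre] at h
  obtain ⟨Δ, D', hΔ, -, hΔβ, hΔI⟩ :=
    exists_isEndlessTimelikeCurve_extends_future (τ := τ.reverse) hn
      ordConnected_Iic (self_mem_Iic (a := -a)) Subset.rfl hβ hβend
  obtain ⟨t₁, ⟨ht₁D', ht₁S⟩, -⟩ := hS.reverse Δ D' hΔ
  by_cases ht₁ : t₁ ≤ -a
  · -- the ray itself meets `S`, at the parameter `-t₁ ≥ a`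
    have hγS : γ (-t₁) ∈ S := by rwa [hΔβ t₁ ht₁] at ht₁S
    have hat₁ : a ≤ -t₁ := le_neg.mpr ht₁
    refine ⟨-t₁, hat₁, fun s hs ↦ ?_⟩
    rcases hs.eq_or_lt with h | hlt
    · rw [← h]
      exact subset_causalFuture g τ S hγS
    · exact Or.inr ⟨γ (-t₁), hγS, γ, -t₁, s, hlt,
        (hγ.mono fun t ht ↦ hat₁.trans ht.1).isFutureCausalCurveOn, rfl, rfl⟩
  · -- the extension meets `S` strictly before `γ a`: then `γ a ∈ I⁺(S)`
    have ht₁' : t₁ ∉ Iic (-a) := ht₁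
    have hI : Δ t₁ ∈ g.chronologicalPast τ {γ a} := by
      have h := hΔI t₁ ht₁D' ht₁'; simp only [neg_neg] at h; exact h
    have haI : γ a ∈ g.chronologicalFuture τ S :=
      chronologicalFuture_mono (singleton_subset_iff.mpr ht₁S)
        (mem_chronologicalFuture_of_mem_chronologicalPast hI)
    refine ⟨a, le_rfl, fun s hs ↦ ?_⟩
    rcases hs.eq_or_lt with h | hlt
    · rw [← h]
      exact chronologicalFuture_subset_causalFuture g τ S haI
    · refine chronologicalFuture_subset_causalFuture g τ S (mem_chronologicalFuture_trans haI ?_)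
      exact ⟨γ a, rfl, γ, a, s, hlt, hγ.mono Icc_subset_Ici_self, rfl, rfl⟩

end LorentzianMetric

namespace PseudoRiemannianMetric

/-! ### Arc length of segments of speed bounded below -/

/-- **Lower bound for the arc length of a segment of speed `≥ c`**: if `|γ'(t)| ≥ c ≥ 0` for all
`t ∈ [a, b]`, then `L(γ|[a, b]) ≥ c (b - a)` (monotonicity of the integral; for `b ≤ a` both the
claim and the length are trivial). O'Neill 1983, Ch. 5, Def. 5.11.
[cite: ONeillSemiRiemannian1983, Ch. 5, Def. 5.11 (pp. 131–132)] -/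
theorem ofReal_mul_le_arcLength {g : PseudoRiemannianMetric I n E (TangentSpace I : M → Type _)}
    {γ : ℝ → M} {a b c : ℝ} (hc : 0 ≤ c) (h : ∀ t ∈ Icc a b, c ≤ g.speed γ t) :
    ENNReal.ofReal (c * (b - a)) ≤ g.arcLength γ a b := by
  rw [arcLength_eq_lintegral_Icc]
  calc ENNReal.ofReal (c * (b - a)) = ∫⁻ _ in Icc a b, ENNReal.ofReal c := by
        rw [setLIntegral_const, Real.volume_Icc, ← ENNReal.ofReal_mul hc]
    _ ≤ ∫⁻ t in Icc a b, ENNReal.ofReal (g.speed γ t) :=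
        setLIntegral_mono' measurableSet_Icc fun t ht ↦ ENNReal.ofReal_le_ofReal (h t ht)

end PseudoRiemannianMetric

end Literature.Geometry.Lorentzian

end
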